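/-
Copyright: the b2b-balaban T⁴-continuum CRUX team, row NE7b OWNER lineage `t4-ne7b-p1` (gen 140). Project licence.
-/
import Summits.QuantumFields.BalabanUV.T4Continuum.Spine.NE7b.SupBlockEffectiveActionThirdDerivative
import Summits.QuantumFields.BalabanUV.T4Continuum.Spine.NE7b.SupBlockFourthMoment
import Summits.QuantumFields.BalabanUV.T4Continuum.Spine.NE7b.SupBlockThirdCumulantForm

/-!
# THE THIRD DERIVATIVE IN TILTED FORM FOR A GENERAL FLUCTUATION COVARIANCE `Γ ⪰ 0` (SCOPING (d12)(1)(iii)) — (424) `SupBlockThirdCumulantForm`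
# RESTATED with `(hΓ : Γ.PosSemidef)` and the measure `N(0,Γ)` in place of `(hM : M.PosDef)` and `N(0,M⁻¹)`: (424)'s proofs used `M ≻ 0`
# only through `hΓ := hM.inv.posSemidef` ((418)∕(419), the object `T(ψ)` and its integrability letters, are general `Γ`), so the unfolding
#   `T(ψ)[h,k,l] = Z⁻¹∫Φ[h,k,l] + Z⁻²(G_hH_kl + G_kH_hl + H_hkG_l) + 2Z⁻³G_hG_kG_l`   (every term a scalar integral against `e^{−U(ω+ψ)}dN(0,Γ)`)
# holds for the road's SINGULAR finite-range `Γ = AAᵀ` — the input of the whitened third-order kernel letter ((468)∕(469)∕(470) and the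
# successor's assembly) (row NE7b, node U5c; (418)∕(419)∕(423) BY NAME; proofs transcribed verbatim from (424); [folklore])

Cell `pub-balaban`, sub-cell `t4`, spine estimate NE7b (`T4WeightBudget.RelWeightBound`; the cell's OWN estimate — NOT PRINTED in
[Bałaban 1983–89], NOT PROVED).  Crux-route work under `Spine/NE7b/` by the row OWNER (`t4-ne7b-p1` gen 140, file (471)) under FREEZE
(0)'s crux-prover clause; NOTHING of Bałaban's is named as a Lean object, valued or asserted; no `T4Continuum/Support` leaf typed; no
`def`, no notation (`T` WRITTEN OUT as in (419)); zero `sorry`.  Imports (BY NAME): as (424) — the OWNER's (419)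
`…SupBlockEffectiveActionThirdDerivative` (the object) and through it (418), (402)∕(403), (423) `…SupBlockFourthMoment`
(`integrable_block_moments`), (400), (399), (313); (424) `…SupBlockThirdCumulantForm` (`phi_apply`, the measure-free product rule).

WHAT IS PROVED ([folklore]; general `Γ ⪰ 0` with the operator letter and the regulator):
* §1 (`phi_apply` is (424)'s, imported), `integrable_phi`, `integral_phi_apply`, `integral_G_apply`, `integral_H_apply`, THE END **`hessW_deriv_apply`** — (424)'s
  statements with `Γ` for `M⁻¹`; §2 toy.

HONEST (what this is NOT).  An identity, transcribed; the centred display for general `Γ` is the next file ((425) restated); the kernel-letter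
assembly of `∂³W` is the successor's; scalar skeleton ((A3), NC-NE7b-α UNRULED); nothing of Bałaban's asserted.  BY-NAME EFFECT ON THE WALL:
NONE.  NE7b NOT PRINTED ∕ NOT PROVED; spine PROVED 0∕9; rung (B)+1 — the programme's measures remain FINITE-torus statements; NOT the mass gap,
NOT Clay.  HONEST DEPENDENCY: continuum YM on T⁴ ⇐ BetaPertH ∧ nine spine estimates (0∕9 proved); BetaPertH ⇐ (D1) ∧ (D4) ∧ CAP+tail; G-an2-4
gates asym, D1 and NE2∕3∕4.
-/

set_option autoImplicit false
set_option maxSynthPendingDepth 3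

noncomputable section

namespace Summit.QuantumFields.BalabanUV.T4Continuum.NE7b.SupBlockThirdCumulantFormGeneral

open MeasureTheory ProbabilityTheory Finset Real Metric
open scoped BigOperators Matrix
open SupEffectiveActionDerivative (integrable_domination mul_opBound_le_of_le)
open SupBlockEffectiveActionDerivative (integrable_weighted_blockDeriv integrable_exp_neg_block)
open SupBlockUpperLetter (integrable_weighted_blockDeriv_apply)
open SupBlockEffectiveActionCovariance (integrable_weightedBlockHess)
open SupBlockEffectiveActionThird (continuous_weightedBlockHess_deriv block_third_domination_op)
open SupBlockFourthMoment (integrable_block_moments)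
open SupBlockThirdCumulantForm (phi_apply)

variable {ι : Type} [Fintype ι] [DecidableEq ι]

section Main

variable {Γ : Matrix ι ι ℝ} {γop m lam : ℝ} {U : EuclideanSpace ℝ ι → ℝ} {U' : EuclideanSpace ℝ ι → EuclideanSpace ℝ ι →L[ℝ] ℝ}
  {U'' : EuclideanSpace ℝ ι → EuclideanSpace ℝ ι →L[ℝ] EuclideanSpace ℝ ι →L[ℝ] ℝ}
  {U₃ : EuclideanSpace ℝ ι → EuclideanSpace ℝ ι →L[ℝ] EuclideanSpace ℝ ι →L[ℝ] EuclideanSpace ℝ ι →L[ℝ] ℝ} {κ₀ κ₁ κ₂ κ₃ a τ δ θ : ℝ}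

/-! ## §1. The raw term on three directions -/

/-- **`Φ(·,ψ)` is Bochner integrable** ((418)'s domination at the centre of the ball). [folklore] -/
theorem integrable_phi (hΓ : Γ.PosSemidef) (hΓop : (γop • (1 : Matrix ι ι ℝ) - Γ).PosSemidef) (Y : Finset ι)
    (hUd : ∀ φ : EuclideanSpace ℝ ι, HasFDerivAt U (U' φ) φ) (hU'd : ∀ φ : EuclideanSpace ℝ ι, HasFDerivAt U' (U'' φ) φ)
    (hU''d : ∀ φ : EuclideanSpace ℝ ι, HasFDerivAt U'' (U₃ φ) φ) (hU₃c : Continuous U₃) (hκ₀ : 0 ≤ κ₀) (hκ₁ : 0 ≤ κ₁) (ha : 0 ≤ a) (hκ₂ : 0 ≤ κ₂) (hκ₃ : 0 ≤ κ₃) (hτ : 0 <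
        τ) (hδ : 0 < δ)
    (hθ1 : θ < 1) (hκθ : (2 * κ₀ * (1 + τ) + 4 * δ) * γop ≤ θ) (hstab : ∀ φ : EuclideanSpace ℝ ι, -(κ₀ * ∑ x ∈ Y, φ x ^ 2) ≤ U φ)
    (hU'b : ∀ φ : EuclideanSpace ℝ ι, ‖U' φ‖ ≤ κ₁ * (a + ∑ x ∈ Y, φ x ^ 2)) (hU''b : ∀ φ : EuclideanSpace ℝ ι, ‖U'' φ‖ ≤ κ₂)
    (hU₃b : ∀ φ : EuclideanSpace ℝ ι, ‖U₃ φ‖ ≤ κ₃) (ψ : EuclideanSpace ℝ ι) :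
    Integrable (fun ω : EuclideanSpace ℝ ι => (exp (-U (ω + ψ)) • (U₃ (ω + ψ) - (((ContinuousLinearMap.smulRightL ℝ (EuclideanSpace ℝ ι) (EuclideanSpace ℝ ι →L[ℝ] ℝ)) (U'
        (ω + ψ))).comp (U'' (ω + ψ)) + (((ContinuousLinearMap.smulRightL ℝ (EuclideanSpace ℝ ι) (EuclideanSpace ℝ ι →L[ℝ] ℝ))).comp (U'' (ω + ψ))).flip (U' (ω + ψ)))) +
        (exp (-U (ω + ψ)) • -U' (ω + ψ)).smulRight (U'' (ω + ψ) - (U' (ω + ψ)).smulRight (U' (ω + ψ))))) (multivariateGaussian 0 Γ) := by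
  exact (integrable_domination hΓ hΓop Y hκ₀ hτ hδ hθ1 hκθ (exp (κ₀ * (1 + τ⁻¹) * (2 * ∑ x ∈ Y, ψ x ^ 2 + 2)) * (κ₁ ^ 3 * (4 * (a + 2 * (2 * ∑ x ∈ Y, ψ x ^ 2 + 2)) ^ 3 + 32
      * (δ ^ 3)⁻¹) + 3 * κ₂ * κ₁ * ((a + 2 * (2 * ∑ x ∈ Y, ψ x ^ 2 + 2)) + δ⁻¹) + κ₃))).mono' (continuous_weightedBlockHess_deriv hUd hU'd hU''d hU₃c
      ψ).aestronglyMeasurable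
    (ae_of_all _ fun ω => block_third_domination_op Y hκ₀ hκ₁ ha hκ₂ hκ₃ hτ hδ hstab hU'b hU''b hU₃b ψ ψ (by rw [sub_self, norm_zero]; exact zero_le_one) ω)

/-- **`(∫Φ)[h,k,l] = ∫Φ[h,k,l]`** (`integral_apply` at three levels). [folklore] -/
theorem integral_phi_apply (hΓ : Γ.PosSemidef) (hΓop : (γop • (1 : Matrix ι ι ℝ) - Γ).PosSemidef) (Y : Finset ι)
    (hUd : ∀ φ : EuclideanSpace ℝ ι, HasFDerivAt U (U' φ) φ) (hU'd : ∀ φ : EuclideanSpace ℝ ι, HasFDerivAt U' (U'' φ) φ)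
    (hU''d : ∀ φ : EuclideanSpace ℝ ι, HasFDerivAt U'' (U₃ φ) φ) (hU₃c : Continuous U₃) (hκ₀ : 0 ≤ κ₀) (hκ₁ : 0 ≤ κ₁) (ha : 0 ≤ a) (hκ₂ : 0 ≤ κ₂) (hκ₃ : 0 ≤ κ₃) (hτ : 0 <
        τ) (hδ : 0 < δ)
    (hθ1 : θ < 1) (hκθ : (2 * κ₀ * (1 + τ) + 4 * δ) * γop ≤ θ) (hstab : ∀ φ : EuclideanSpace ℝ ι, -(κ₀ * ∑ x ∈ Y, φ x ^ 2) ≤ U φ)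
    (hU'b : ∀ φ : EuclideanSpace ℝ ι, ‖U' φ‖ ≤ κ₁ * (a + ∑ x ∈ Y, φ x ^ 2)) (hU''b : ∀ φ : EuclideanSpace ℝ ι, ‖U'' φ‖ ≤ κ₂)
    (hU₃b : ∀ φ : EuclideanSpace ℝ ι, ‖U₃ φ‖ ≤ κ₃) (ψ h k l : EuclideanSpace ℝ ι) :
    (∫ ω : EuclideanSpace ℝ ι, (exp (-U (ω + ψ)) • (U₃ (ω + ψ) - (((ContinuousLinearMap.smulRightL ℝ (EuclideanSpace ℝ ι) (EuclideanSpace ℝ ι →L[ℝ] ℝ)) (U' (ω + ψ))).comp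
        (U'' (ω + ψ)) + (((ContinuousLinearMap.smulRightL ℝ (EuclideanSpace ℝ ι) (EuclideanSpace ℝ ι →L[ℝ] ℝ))).comp (U'' (ω + ψ))).flip (U' (ω + ψ)))) + (exp (-U (ω + ψ))
        • -U' (ω + ψ)).smulRight (U'' (ω + ψ) - (U' (ω + ψ)).smulRight (U' (ω + ψ)))) ∂(multivariateGaussian 0 Γ)) h k l = (∫ ω : EuclideanSpace ℝ ι, (exp (-U (ω + ψ)) *
        (U₃ (ω + ψ) h k l - U' (ω + ψ) k * U'' (ω + ψ) h l - U'' (ω + ψ) h k * U' (ω + ψ) l - U' (ω + ψ) h * U'' (ω + ψ) k l + U' (ω + ψ) h * U' (ω + ψ) k * U' (ω + ψ) l))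
        ∂(multivariateGaussian 0 Γ)) := by
  have hI := integrable_phi hΓ hΓop Y hUd hU'd hU''d hU₃c hκ₀ hκ₁ ha hκ₂ hκ₃ hτ hδ hθ1 hκθ hstab hU'b hU''b hU₃b ψ
  have hI1 : Integrable (fun ω : EuclideanSpace ℝ ι => (exp (-U (ω + ψ)) • (U₃ (ω + ψ) - (((ContinuousLinearMap.smulRightL ℝ (EuclideanSpace ℝ ι) (EuclideanSpace ℝ ι →L[ℝ]
      ℝ)) (U' (ω + ψ))).comp (U'' (ω + ψ)) + (((ContinuousLinearMap.smulRightL ℝ (EuclideanSpace ℝ ι) (EuclideanSpace ℝ ι →L[ℝ] ℝ))).comp (U'' (ω + ψ))).flip (U' (ω + ψ))))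
      + (exp (-U (ω + ψ)) • -U' (ω + ψ)).smulRight (U'' (ω + ψ) - (U' (ω + ψ)).smulRight (U' (ω + ψ)))) h) (multivariateGaussian 0 Γ) :=
    (ContinuousLinearMap.apply ℝ (EuclideanSpace ℝ ι →L[ℝ] EuclideanSpace ℝ ι →L[ℝ] ℝ) h).integrable_comp hI
  have hI2 : Integrable (fun ω : EuclideanSpace ℝ ι => (exp (-U (ω + ψ)) • (U₃ (ω + ψ) - (((ContinuousLinearMap.smulRightL ℝ (EuclideanSpace ℝ ι) (EuclideanSpace ℝ ι →L[ℝ]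
      ℝ)) (U' (ω + ψ))).comp (U'' (ω + ψ)) + (((ContinuousLinearMap.smulRightL ℝ (EuclideanSpace ℝ ι) (EuclideanSpace ℝ ι →L[ℝ] ℝ))).comp (U'' (ω + ψ))).flip (U' (ω + ψ))))
      + (exp (-U (ω + ψ)) • -U' (ω + ψ)).smulRight (U'' (ω + ψ) - (U' (ω + ψ)).smulRight (U' (ω + ψ)))) h k) (multivariateGaussian 0 Γ) :=
    (ContinuousLinearMap.apply ℝ (EuclideanSpace ℝ ι →L[ℝ] ℝ) k).integrable_comp hI1
  rw [ContinuousLinearMap.integral_apply hI h, ContinuousLinearMap.integral_apply hI1 k, ContinuousLinearMap.integral_apply hI2 l]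
  exact integral_congr_ae (ae_of_all _ fun ω => phi_apply U U' U'' U₃ ψ ω h k l)

/-- `G[v] = ∫e^{−U}A_v`. [folklore] -/
theorem integral_G_apply (hΓ : Γ.PosSemidef) (hΓop : (γop • (1 : Matrix ι ι ℝ) - Γ).PosSemidef) (Y : Finset ι)
    (hUd : ∀ φ : EuclideanSpace ℝ ι, HasFDerivAt U (U' φ) φ) (hU'd : ∀ φ : EuclideanSpace ℝ ι, HasFDerivAt U' (U'' φ) φ)
    (hκ₀ : 0 ≤ κ₀) (hκ₁ : 0 ≤ κ₁) (ha : 0 ≤ a) (hτ : 0 < τ) (hδ : 0 < δ)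
    (hθ1 : θ < 1) (hκθ : (2 * κ₀ * (1 + τ) + 4 * δ) * γop ≤ θ) (hstab : ∀ φ : EuclideanSpace ℝ ι, -(κ₀ * ∑ x ∈ Y, φ x ^ 2) ≤ U φ)
    (hU'b : ∀ φ : EuclideanSpace ℝ ι, ‖U' φ‖ ≤ κ₁ * (a + ∑ x ∈ Y, φ x ^ 2)) (ψ v : EuclideanSpace ℝ ι) :
    (∫ ω : EuclideanSpace ℝ ι, exp (-U (ω + ψ)) • U' (ω + ψ) ∂(multivariateGaussian 0 Γ)) v = (∫ ω : EuclideanSpace ℝ ι, exp (-U (ω + ψ)) * U' (ω + ψ) v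
        ∂(multivariateGaussian 0 Γ)) := by
  have hU'c : Continuous U' := continuous_iff_continuousAt.2 fun φ => (hU'd φ).continuousAt
  rw [ContinuousLinearMap.integral_apply (integrable_weighted_blockDeriv hΓ hΓop Y hUd hU'c hκ₀ hκ₁ ha hτ hδ hθ1 hκθ hstab hU'b ψ)]
  exact integral_congr_ae (ae_of_all _ fun ω => by simp only [_root_.smul_apply, smul_eq_mul])

/-- `H[v,w] = ∫e^{−U}(B_vw − A_vA_w)`. [folklore] -/
theorem integral_H_apply (hΓ : Γ.PosSemidef) (hΓop : (γop • (1 : Matrix ι ι ℝ) - Γ).PosSemidef) (Y : Finset ι)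
    (hUd : ∀ φ : EuclideanSpace ℝ ι, HasFDerivAt U (U' φ) φ) (hU'd : ∀ φ : EuclideanSpace ℝ ι, HasFDerivAt U' (U'' φ) φ)
    (hU''d : ∀ φ : EuclideanSpace ℝ ι, HasFDerivAt U'' (U₃ φ) φ) (hκ₀ : 0 ≤ κ₀) (hκ₁ : 0 ≤ κ₁) (ha : 0 ≤ a) (hκ₂ : 0 ≤ κ₂) (hτ : 0 < τ) (hδ : 0 < δ)
    (hθ1 : θ < 1) (hκθ : (2 * κ₀ * (1 + τ) + 4 * δ) * γop ≤ θ) (hstab : ∀ φ : EuclideanSpace ℝ ι, -(κ₀ * ∑ x ∈ Y, φ x ^ 2) ≤ U φ)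
    (hU'b : ∀ φ : EuclideanSpace ℝ ι, ‖U' φ‖ ≤ κ₁ * (a + ∑ x ∈ Y, φ x ^ 2)) (hU''b : ∀ φ : EuclideanSpace ℝ ι, ‖U'' φ‖ ≤ κ₂) (ψ v w : EuclideanSpace ℝ ι) :
    (∫ ω : EuclideanSpace ℝ ι, exp (-U (ω + ψ)) • (U'' (ω + ψ) - (U' (ω + ψ)).smulRight (U' (ω + ψ))) ∂(multivariateGaussian 0 Γ)) v w = (∫ ω : EuclideanSpace ℝ ι, exp
        (-U (ω + ψ)) * (U'' (ω + ψ) v w - U' (ω + ψ) v * U' (ω + ψ) w) ∂(multivariateGaussian 0 Γ)) := by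
  have hU''c : Continuous U'' := continuous_iff_continuousAt.2 fun φ => (hU''d φ).continuousAt
  have hHint := integrable_weightedBlockHess hΓ hΓop Y hUd hU'd hU''c hκ₀ hκ₁ ha hκ₂ hτ hδ hθ1 hκθ hstab hU'b hU''b ψ
  have hH1 : Integrable (fun ω : EuclideanSpace ℝ ι => (exp (-U (ω + ψ)) • (U'' (ω + ψ) - (U' (ω + ψ)).smulRight (U' (ω + ψ)))) v) (multivariateGaussian 0 Γ) :=
    (ContinuousLinearMap.apply ℝ (EuclideanSpace ℝ ι →L[ℝ] ℝ) v).integrable_comp hHint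
  rw [ContinuousLinearMap.integral_apply hHint v, ContinuousLinearMap.integral_apply hH1 w]
  exact integral_congr_ae (ae_of_all _ fun ω => by
    simp only [_root_.smul_apply, _root_.sub_apply, smul_eq_mul, ContinuousLinearMap.smulRight_apply])

/-- **THE RAW TERM ON THREE DIRECTIONS**: `T(ψ)[h,k,l] = Z⁻¹∫Φ[h,k,l] + Z⁻²(G_hH_kl + G_kH_hl + H_hkG_l) + 2Z⁻³G_hG_kG_l` written with the
scalar integrals. [folklore] -/
theorem hessW_deriv_apply (hΓ : Γ.PosSemidef) (hΓop : (γop • (1 : Matrix ι ι ℝ) - Γ).PosSemidef) (Y : Finset ι)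
    (hUd : ∀ φ : EuclideanSpace ℝ ι, HasFDerivAt U (U' φ) φ) (hU'd : ∀ φ : EuclideanSpace ℝ ι, HasFDerivAt U' (U'' φ) φ)
    (hU''d : ∀ φ : EuclideanSpace ℝ ι, HasFDerivAt U'' (U₃ φ) φ) (hU₃c : Continuous U₃) (hκ₀ : 0 ≤ κ₀) (hκ₁ : 0 ≤ κ₁) (ha : 0 ≤ a) (hκ₂ : 0 ≤ κ₂) (hκ₃ : 0 ≤ κ₃) (hτ : 0 <
        τ) (hδ : 0 < δ)
    (hθ1 : θ < 1) (hκθ : (2 * κ₀ * (1 + τ) + 4 * δ) * γop ≤ θ) (hstab : ∀ φ : EuclideanSpace ℝ ι, -(κ₀ * ∑ x ∈ Y, φ x ^ 2) ≤ U φ)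
    (hU'b : ∀ φ : EuclideanSpace ℝ ι, ‖U' φ‖ ≤ κ₁ * (a + ∑ x ∈ Y, φ x ^ 2)) (hU''b : ∀ φ : EuclideanSpace ℝ ι, ‖U'' φ‖ ≤ κ₂)
    (hU₃b : ∀ φ : EuclideanSpace ℝ ι, ‖U₃ φ‖ ≤ κ₃) (ψ h k l : EuclideanSpace ℝ ι) :
    (((∫ ω : EuclideanSpace ℝ ι, exp (-U (ω + ψ)) ∂(multivariateGaussian 0 Γ))⁻¹ • (∫ ω : EuclideanSpace ℝ ι, (exp (-U (ω + ψ)) • (U₃ (ω + ψ) -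
        (((ContinuousLinearMap.smulRightL ℝ (EuclideanSpace ℝ ι) (EuclideanSpace ℝ ι →L[ℝ] ℝ)) (U' (ω + ψ))).comp (U'' (ω + ψ)) + (((ContinuousLinearMap.smulRightL ℝ
        (EuclideanSpace ℝ ι) (EuclideanSpace ℝ ι →L[ℝ] ℝ))).comp (U'' (ω + ψ))).flip (U' (ω + ψ)))) + (exp (-U (ω + ψ)) • -U' (ω + ψ)).smulRight (U'' (ω + ψ) - (U' (ω +
        ψ)).smulRight (U' (ω + ψ)))) ∂(multivariateGaussian 0 Γ)) + ((-((∫ ω : EuclideanSpace ℝ ι, exp (-U (ω + ψ)) ∂(multivariateGaussian 0 Γ)) ^ 2)⁻¹) • -(∫ ω :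
        EuclideanSpace ℝ ι, exp (-U (ω + ψ)) • U' (ω + ψ) ∂(multivariateGaussian 0 Γ))).smulRight (∫ ω : EuclideanSpace ℝ ι, exp (-U (ω + ψ)) • (U'' (ω + ψ) - (U' (ω +
        ψ)).smulRight (U' (ω + ψ))) ∂(multivariateGaussian 0 Γ))) + (((ContinuousLinearMap.smulRightL ℝ (EuclideanSpace ℝ ι) (EuclideanSpace ℝ ι →L[ℝ] ℝ)) (((∫ ω :
        EuclideanSpace ℝ ι, exp (-U (ω + ψ)) ∂(multivariateGaussian 0 Γ)) ^ 2)⁻¹ • (∫ ω : EuclideanSpace ℝ ι, exp (-U (ω + ψ)) • U' (ω + ψ) ∂(multivariateGaussian 0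
        Γ)))).comp (∫ ω : EuclideanSpace ℝ ι, exp (-U (ω + ψ)) • (U'' (ω + ψ) - (U' (ω + ψ)).smulRight (U' (ω + ψ))) ∂(multivariateGaussian 0 Γ)) +
        (((ContinuousLinearMap.smulRightL ℝ (EuclideanSpace ℝ ι) (EuclideanSpace ℝ ι →L[ℝ] ℝ))).comp (((∫ ω : EuclideanSpace ℝ ι, exp (-U (ω + ψ)) ∂(multivariateGaussian 0
        Γ)) ^ 2)⁻¹ • (∫ ω : EuclideanSpace ℝ ι, exp (-U (ω + ψ)) • (U'' (ω + ψ) - (U' (ω + ψ)).smulRight (U' (ω + ψ))) ∂(multivariateGaussian 0 Γ)) + ((-2 / (∫ ω :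
        EuclideanSpace ℝ ι, exp (-U (ω + ψ)) ∂(multivariateGaussian 0 Γ)) ^ 3) • -(∫ ω : EuclideanSpace ℝ ι, exp (-U (ω + ψ)) • U' (ω + ψ) ∂(multivariateGaussian 0
        Γ))).smulRight (∫ ω : EuclideanSpace ℝ ι, exp (-U (ω + ψ)) • U' (ω + ψ) ∂(multivariateGaussian 0 Γ)))).flip (∫ ω : EuclideanSpace ℝ ι, exp (-U (ω + ψ)) • U' (ω
        + ψ) ∂(multivariateGaussian 0 Γ)))) h k l =
      ((∫ ω : EuclideanSpace ℝ ι, exp (-U (ω + ψ)) ∂(multivariateGaussian 0 Γ))⁻¹ * (∫ ω : EuclideanSpace ℝ ι, (exp (-U (ω + ψ)) * (U₃ (ω + ψ) h k l - U' (ω + ψ) k * U''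
          (ω + ψ) h l - U'' (ω + ψ) h k * U' (ω + ψ) l - U' (ω + ψ) h * U'' (ω + ψ) k l + U' (ω + ψ) h * U' (ω + ψ) k * U' (ω + ψ) l)) ∂(multivariateGaussian 0 Γ)) + ((∫
          ω : EuclideanSpace ℝ ι, exp (-U (ω + ψ)) ∂(multivariateGaussian 0 Γ)) ^ 2)⁻¹ * (∫ ω : EuclideanSpace ℝ ι, exp (-U (ω + ψ)) * U' (ω + ψ) h ∂(multivariateGaussian
          0 Γ)) * (∫ ω : EuclideanSpace ℝ ι, exp (-U (ω + ψ)) * (U'' (ω + ψ) k l - U' (ω + ψ) k * U' (ω + ψ) l) ∂(multivariateGaussian 0 Γ)) + ((∫ ω : EuclideanSpace ℝ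
          ι, exp (-U (ω + ψ)) ∂(multivariateGaussian 0 Γ)) ^ 2)⁻¹ * (∫ ω : EuclideanSpace ℝ ι, exp (-U (ω + ψ)) * U' (ω + ψ) k ∂(multivariateGaussian 0 Γ)) * (∫ ω :
          EuclideanSpace ℝ ι, exp (-U (ω + ψ)) * (U'' (ω + ψ) h l - U' (ω + ψ) h * U' (ω + ψ) l) ∂(multivariateGaussian 0 Γ)) + (((∫ ω : EuclideanSpace ℝ ι, exp (-U (ω +
          ψ)) ∂(multivariateGaussian 0 Γ)) ^ 2)⁻¹ * (∫ ω : EuclideanSpace ℝ ι, exp (-U (ω + ψ)) * (U'' (ω + ψ) h k - U' (ω + ψ) h * U' (ω + ψ) k) ∂(multivariateGaussian 0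
          Γ)) + -2 / (∫ ω : EuclideanSpace ℝ ι, exp (-U (ω + ψ)) ∂(multivariateGaussian 0 Γ)) ^ 3 * -(∫ ω : EuclideanSpace ℝ ι, exp (-U (ω + ψ)) * U' (ω + ψ) h
          ∂(multivariateGaussian 0 Γ)) * (∫ ω : EuclideanSpace ℝ ι, exp (-U (ω + ψ)) * U' (ω + ψ) k ∂(multivariateGaussian 0 Γ))) * (∫ ω : EuclideanSpace ℝ ι, exp (-U
          (ω + ψ)) * U' (ω + ψ) l ∂(multivariateGaussian 0 Γ))) := by
  simp only [_root_.add_apply, _root_.smul_apply, ContinuousLinearMap.smulRight_apply, ContinuousLinearMap.comp_apply,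
    ContinuousLinearMap.flip_apply, ContinuousLinearMap.smulRightL_apply_apply, smul_eq_mul, _root_.neg_apply]
  rw [integral_phi_apply hΓ hΓop Y hUd hU'd hU''d hU₃c hκ₀ hκ₁ ha hκ₂ hκ₃ hτ hδ hθ1 hκθ hstab hU'b hU''b hU₃b ψ h k l, integral_G_apply hΓ hΓop Y hUd hU'd hκ₀ hκ₁ ha hτ hδ
      hθ1 hκθ hstab hU'b ψ h, integral_G_apply hΓ hΓop Y hUd hU'd hκ₀ hκ₁ ha hτ hδ hθ1 hκθ hstab hU'b ψ k, integral_G_apply hΓ hΓop Y hUd hU'd hκ₀ hκ₁ ha hτ hδ hθ1 hκθ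
      hstab hU'b ψ l,
    integral_H_apply hΓ hΓop Y hUd hU'd hU''d hκ₀ hκ₁ ha hκ₂ hτ hδ hθ1 hκθ hstab hU'b hU''b ψ k l, integral_H_apply hΓ hΓop Y hUd hU'd hU''d hκ₀ hκ₁ ha hκ₂ hτ hδ hθ1 hκθ
        hstab hU'b hU''b ψ h l, integral_H_apply hΓ hΓop Y hUd hU'd hU''d hκ₀ hκ₁ ha hκ₂ hτ hδ hθ1 hκθ hstab hU'b hU''b ψ h k]
  ring

end Main

/-! ## §2. Toy -/

/-- Toy (§1's algebra): the sign pattern of the product rule. -/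
example (e c ak bhl bhk al ah bkl : ℝ) : e * (c - (ak * bhl + bhk * al)) + (e * -ah) * (bkl - ak * al) = e * (c - ak * bhl - bhk * al - ah * bkl + ah * ak * al) := by
  ring

end Summit.QuantumFields.BalabanUV.T4Continuum.NE7b.SupBlockThirdCumulantFormGeneral
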